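import HarnessLib
import Summits.CriticalPhenomena.Ising3DConformalLimit.Theorems.HarmonicMomentsIsotropyTwoPointAsymptoticIsotropyOfRayRV
import Summits.CriticalPhenomena.Ising3DConformalLimit.Theorems.HarmonicMomentsIsotropyTwoPointAsymptoticIsotropyRayRatiosPower
import Literature.Probability.LatticeModels.PointwiseScalingLimitEtaExists

/-!
# Vague asymptotic isotropy of the critical `ℤ³` two-point function, XXX-B:
# CONVERGENT RAY RATIOS SUFFICE — the exponents are automatic and automatically equal
(route HarmonicMomentsIsotropy, support item stmt-CriticalPhenomena-6036 `TwoPointAsymptoticIsotropy`;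
ray-regular-variation line of seat c4, exponent-free form)

Write `G = criticalTwoPoint 3`. File XXIX proved the milestone under RAY REGULAR VARIATION with a
common exponent `a` (`G(kmx)/G(mx) → k^{-a}` on every lattice ray). Here the exponent is removed from
the hypothesis altogether:

**Theorem** (`twoPointAsymptoticIsotropy_of_rayRatioConvergence`). If for every `x ∈ ℤ³ ∖ {0}` and
every `k ≥ 1` the ray ratio `m ↦ G(k m x) / G(m x)` CONVERGES (to some limit, a priori depending on
the ray and on `k`), then `TwoPointAsymptoticIsotropy` holds.

So each lattice ray is looked at separately and only the existence of its own ratio limits is asked;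
that the limits are powers `k^{-a_x}` (`exists_rpow_of_rayRatios`) and that all rays carry the SAME
exponent (`exponent_eq_axis_of_tendsto`) are theorems:
* the axis ratio at `k = 2` gives doubling, uniform regularity and cluster points of the pinned
  zoom, and on each ray the limits are powers `k^{-a_x}` (first half, `…RayRatiosPower`:
  `uniformRegularity_of_rayRatios`, `exists_rpow_of_rayRatios`);
* the Messager–Miracle-Solé sphere sandwich `g(3‖y‖_∞) ≤ G(y) ≤ g(‖y‖_∞)`
  (`criticalTwoPoint_axis_sandwich`) compares every ray with the axis and forces `a_x = a_{e₀}`;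
* file XXIX's `twoPointAsymptoticIsotropy_of_rayRV` concludes.

References: H. Duminil-Copin, ICM 2022, §8.1, §8.4 [DuminilCopinICM2022]; A. Messager,
S. Miracle-Solé, J. Stat. Phys. 17 (1977) [MessagerMiracleSoleJSP1977]; N. H. Bingham, C. M. Goldie,
J. L. Teugels, *Regular Variation* (CUP 1987), §1.9. No definitions are introduced (`RayRV[a]`,
`RayRatios` are local notations).
-/

noncomputable section

namespace Summit.CriticalPhenomena.Ising3DConformalLimit.HarmonicMomentsIsotropyTwoPoint.RayRV

open Literature.Probability.LatticeModels Filter Set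
open scoped Topology
open Summit.CriticalPhenomena.Ising3DConformalLimit.MoebiusLimitExistsOnlyInteraction (rhoPin rhoPin_pos)
open Summit.CriticalPhenomena.Ising3DConformalLimit.MoebiusLimitExistsNegative (tendsto_div_succ_nhdsGT)
open Summit.CriticalPhenomena.Ising3DConformalLimit.HyperoctahedralRPTwoPoint
open Summit.CriticalPhenomena.Ising3DConformalLimit.Theses.HarmonicMomentsIsotropy
open Summit.CriticalPhenomena.Ising3DConformalLimit.Theses

/-- `RayRV[a]`: RAY REGULAR VARIATION of the critical two-point function with exponent `a` — on every
lattice ray `ℕ·x`, `x ∈ ℤ³ ∖ {0}`, `⟨σ₀σ_{kmx}⟩_{β_c} / ⟨σ₀σ_{mx}⟩_{β_c} → k^{-a}` as `m → ∞`, for every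
`k ≥ 1` (local notation, no new definition). -/
local notation3 (prettyPrint := false) "RayRV[" a "]" =>
  ∀ x : Site 3, x ≠ 0 → ∀ k : ℕ, 1 ≤ k →
    Tendsto (fun m : ℕ => criticalTwoPoint 3 (fun i => ((k * m : ℕ) : ℤ) * x i) /
      criticalTwoPoint 3 (fun i => ((m : ℕ) : ℤ) * x i)) atTop (𝓝 ((k : ℝ) ^ (-a)))

/-- `RayRatios`: CONVERGENCE OF THE RAY RATIOS — on every lattice ray `ℕ·x`, `x ∈ ℤ³ ∖ {0}`, and for
every `k ≥ 1`, the ratio `⟨σ₀σ_{kmx}⟩_{β_c} / ⟨σ₀σ_{mx}⟩_{β_c}` converges as `m → ∞` (to an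
unspecified limit) (local notation, no new definition). -/
local notation3 (prettyPrint := false) "RayRatios" =>
  ∀ x : Site 3, x ≠ 0 → ∀ k : ℕ, 1 ≤ k → ∃ L : ℝ,
    Tendsto (fun m : ℕ => criticalTwoPoint 3 (fun i => ((k * m : ℕ) : ℤ) * x i) /
      criticalTwoPoint 3 (fun i => ((m : ℕ) : ℤ) * x i)) atTop (𝓝 L)

/-! ### All rays carry the same exponent -/

/-- Sup norm of an integer multiple: `‖(c xᵢ)ᵢ‖_∞ = c ‖x‖_∞` for `c ∈ ℕ`. [folklore] -/
theorem supNorm_natMul (c : ℕ) (x : Site 3) :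
    Site.supNorm (fun i => ((c : ℕ) : ℤ) * x i) = c * Site.supNorm x := by
  unfold Site.supNorm
  have hmono : Monotone fun n : ℕ => c * n := fun a b hab => Nat.mul_le_mul_left c hab
  rw [Finset.apply_sup_eq_sup_comp (fun n : ℕ => c * n) (fun a b => hmono.map_max) (by simp)]
  congr 1
  funext i
  simp [Int.natAbs_mul, Int.natAbs_natCast]

/-- **All rays carry the axis exponent.** If the axis ratios tend to `k^{-a₀}` and the ratios along
`x ≠ 0` tend to `k^{-a}` (all `k ≥ 1`), then `a = a₀`: by the Messager–Miracle-Solé sphere sandwich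
`g(3‖y‖_∞) ≤ G(y) ≤ g(‖y‖_∞)` (`criticalTwoPoint_axis_sandwich`),
`3^{-a₀} k^{-a₀} ≤ k^{-a} ≤ 3^{a₀} k^{-a₀}` for every `k`, which pins the exponent.
[cite: MessagerMiracleSoleJSP1977, main theorem (monotonicity of ⟨σ₀σ_x⟩ under reflections)] -/
theorem exponent_eq_axis_of_tendsto {a₀ a : ℝ}
    (h₀ : ∀ k : ℕ, 1 ≤ k → Tendsto (fun m : ℕ =>
      criticalTwoPoint 3 (fun i => ((k * m : ℕ) : ℤ) * (Pi.single (0 : Fin 3) (1 : ℤ) : Site 3) i) /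
      criticalTwoPoint 3 (fun i => ((m : ℕ) : ℤ) * (Pi.single (0 : Fin 3) (1 : ℤ) : Site 3) i))
      atTop (𝓝 ((k : ℝ) ^ (-a₀))))
    {x : Site 3} (hx : x ≠ 0)
    (hxk : ∀ k : ℕ, 1 ≤ k → Tendsto (fun m : ℕ =>
      criticalTwoPoint 3 (fun i => ((k * m : ℕ) : ℤ) * x i) /
      criticalTwoPoint 3 (fun i => ((m : ℕ) : ℤ) * x i)) atTop (𝓝 ((k : ℝ) ^ (-a)))) :
    a = a₀ := by
  set g : ℕ → ℝ := fun n => criticalTwoPoint 3 (Pi.single 0 (n : ℤ)) with hg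
  have hgpos : ∀ n, 0 < g n := fun n => PinnedClusterPoints.criticalTwoPoint_pos3 _
  have hGpos : ∀ z : Site 3, 0 < criticalTwoPoint 3 z := fun z => PinnedClusterPoints.criticalTwoPoint_pos3 z
  -- the axis ratios in terms of `g`
  have h₀' : ∀ k : ℕ, 1 ≤ k → Tendsto (fun m : ℕ => g (k * m) / g m) atTop (𝓝 ((k : ℝ) ^ (-a₀))) := by
    intro k hk
    refine (h₀ k hk).congr fun m => ?_
    simp only [hg, intMul_single_one]
  -- the sup norm of `x` and of its multiples
  set c : ℕ := Site.supNorm x with hc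
  have hc1 : 1 ≤ c := by
    rw [hc]
    by_contra h
    push Not at h
    have h0 : Site.supNorm x = 0 := by omega
    apply hx
    funext i
    have := Site.natAbs_le_supNorm x i
    rw [h0] at this
    simpa using this
  have hsup : ∀ n : ℕ, Site.supNorm (fun i => ((n : ℕ) : ℤ) * x i) = n * c := fun n =>
    supNorm_natMul n x
  -- sandwich bounds for the ratio along `x`
  have hupper : ∀ k : ℕ, 1 ≤ k → ∀ m : ℕ, 1 ≤ m →
      criticalTwoPoint 3 (fun i => ((k * m : ℕ) : ℤ) * x i) /
        criticalTwoPoint 3 (fun i => ((m : ℕ) : ℤ) * x i) ≤ g (k * (m * c)) / g (3 * (m * c)) := by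
    intro k hk m hm
    have hkm : 1 ≤ Site.supNorm (fun i => ((k * m : ℕ) : ℤ) * x i) := by
      rw [hsup]; exact Nat.one_le_iff_ne_zero.2 (by positivity)
    have hm1 : 1 ≤ Site.supNorm (fun i => ((m : ℕ) : ℤ) * x i) := by
      rw [hsup]; exact Nat.one_le_iff_ne_zero.2 (by positivity)
    have h1 := (criticalTwoPoint_axis_sandwich hkm).2
    have h2 := (criticalTwoPoint_axis_sandwich hm1).1
    rw [hsup] at h1 h2
    have e1 : k * m * c = k * (m * c) := by ring
    have e2 : 3 * (m * c) = 3 * (m * c) := rfl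
    rw [e1] at h1
    calc criticalTwoPoint 3 (fun i => ((k * m : ℕ) : ℤ) * x i) /
          criticalTwoPoint 3 (fun i => ((m : ℕ) : ℤ) * x i)
        ≤ g (k * (m * c)) / criticalTwoPoint 3 (fun i => ((m : ℕ) : ℤ) * x i) :=
          div_le_div_of_nonneg_right h1 (hGpos _).le
      _ ≤ g (k * (m * c)) / g (3 * (m * c)) :=
          div_le_div_of_nonneg_left (hgpos _).le (hgpos _) h2
  have hlower : ∀ k : ℕ, 1 ≤ k → ∀ m : ℕ, 1 ≤ m →
      g (3 * k * (m * c)) / g (m * c) ≤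
        criticalTwoPoint 3 (fun i => ((k * m : ℕ) : ℤ) * x i) /
          criticalTwoPoint 3 (fun i => ((m : ℕ) : ℤ) * x i) := by
    intro k hk m hm
    have hkm : 1 ≤ Site.supNorm (fun i => ((k * m : ℕ) : ℤ) * x i) := by
      rw [hsup]; exact Nat.one_le_iff_ne_zero.2 (by positivity)
    have hm1 : 1 ≤ Site.supNorm (fun i => ((m : ℕ) : ℤ) * x i) := by
      rw [hsup]; exact Nat.one_le_iff_ne_zero.2 (by positivity)
    have h1 := (criticalTwoPoint_axis_sandwich hkm).1
    have h2 := (criticalTwoPoint_axis_sandwich hm1).2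
    rw [hsup] at h1 h2
    have e1 : 3 * (k * m * c) = 3 * k * (m * c) := by ring
    rw [e1] at h1
    calc g (3 * k * (m * c)) / g (m * c)
        ≤ criticalTwoPoint 3 (fun i => ((k * m : ℕ) : ℤ) * x i) / g (m * c) :=
          div_le_div_of_nonneg_right h1 (hgpos _).le
      _ ≤ criticalTwoPoint 3 (fun i => ((k * m : ℕ) : ℤ) * x i) /
            criticalTwoPoint 3 (fun i => ((m : ℕ) : ℤ) * x i) :=
          div_le_div_of_nonneg_left (hGpos _).le (hGpos _) h2
  -- limits of the bounds along `n = m c → ∞`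
  have hmc : Tendsto (fun m : ℕ => m * c) atTop atTop :=
    tendsto_id.atTop_mul_const' hc1  -- `m ↦ m * c`
  have hup_lim : ∀ k : ℕ, 1 ≤ k → Tendsto (fun m : ℕ => g (k * (m * c)) / g (3 * (m * c))) atTop
      (𝓝 ((k : ℝ) ^ (-a₀) / (3 : ℝ) ^ (-a₀))) := by
    intro k hk
    have hk' := (h₀' k hk).comp hmc
    have h3 := (h₀' 3 (by norm_num)).comp hmc
    have h3pos : (0:ℝ) < (3 : ℝ) ^ (-a₀) := Real.rpow_pos_of_pos (by norm_num) _
    have h := hk'.div h3 (by exact_mod_cast h3pos.ne')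
    refine (h.congr fun m => ?_).trans ?_
    · simp only [Function.comp_apply, Pi.div_apply]
      rw [div_div_div_cancel_right₀ (hgpos _).ne']
    · norm_num
  have hlow_lim : ∀ k : ℕ, 1 ≤ k → Tendsto (fun m : ℕ => g (3 * k * (m * c)) / g (m * c)) atTop
      (𝓝 (((3 * k : ℕ) : ℝ) ^ (-a₀))) := by
    intro k hk
    exact ((h₀' (3 * k) (by omega)).comp hmc).congr fun m => by simp only [Function.comp_apply]
  -- hence `3^{-a₀} k^{-a₀} ≤ k^{-a} ≤ 3^{a₀} k^{-a₀}` for all `k ≥ 1`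
  have hineq : ∀ k : ℕ, 1 ≤ k →
      ((3 * k : ℕ) : ℝ) ^ (-a₀) ≤ (k : ℝ) ^ (-a) ∧ (k : ℝ) ^ (-a) ≤ (k : ℝ) ^ (-a₀) / (3 : ℝ) ^ (-a₀) := by
    intro k hk
    constructor
    · refine le_of_tendsto_of_tendsto (hlow_lim k hk) (hxk k hk) ?_
      filter_upwards [eventually_ge_atTop 1] with m hm using hlower k hk m hm
    · refine le_of_tendsto_of_tendsto (hxk k hk) (hup_lim k hk) ?_
      filter_upwards [eventually_ge_atTop 1] with m hm using hupper k hk m hm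
  -- pin the exponent
  have hpow : ∀ k : ℕ, 1 ≤ k →
      (3 : ℝ) ^ (-a₀) ≤ (k : ℝ) ^ (a₀ - a) ∧ (k : ℝ) ^ (a₀ - a) ≤ (3 : ℝ) ^ a₀ := by
    intro k hk
    have hk0 : (0:ℝ) < k := by exact_mod_cast hk
    have hka : 0 < (k : ℝ) ^ (-a₀) := Real.rpow_pos_of_pos hk0 _
    obtain ⟨h1, h2⟩ := hineq k hk
    have hsplit : (k : ℝ) ^ (-a) = (k : ℝ) ^ (a₀ - a) * (k : ℝ) ^ (-a₀) := by
      rw [← Real.rpow_add hk0]; congr 1; ring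
    constructor
    · rw [Nat.cast_mul, Nat.cast_ofNat, Real.mul_rpow (by norm_num) hk0.le, hsplit] at h1
      exact le_of_mul_le_mul_right h1 hka
    · rw [hsplit, Real.rpow_neg (by norm_num : (0:ℝ) ≤ 3), div_inv_eq_mul,
        mul_comm ((k : ℝ) ^ (-a₀))] at h2
      exact le_of_mul_le_mul_right h2 hka
  by_contra hne
  rcases lt_or_gt_of_ne hne with hlt | hgt
  · -- `a < a₀`: `k^{a₀ - a} → ∞`
    have ht : Tendsto (fun k : ℕ => (k : ℝ) ^ (a₀ - a)) atTop atTop :=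
      (tendsto_rpow_atTop (by linarith)).comp tendsto_natCast_atTop_atTop
    obtain ⟨k, hk⟩ := ((ht.eventually_gt_atTop ((3 : ℝ) ^ a₀)).and (eventually_ge_atTop 1)).exists
    exact absurd (hpow k hk.2).2 (not_le.2 hk.1)
  · -- `a₀ < a`: `k^{a₀ - a} → 0`
    have ht : Tendsto (fun k : ℕ => (k : ℝ) ^ (a₀ - a)) atTop (𝓝 0) :=
      ((tendsto_rpow_neg_atTop (y := a - a₀) (by linarith)).comp tendsto_natCast_atTop_atTop).congr
        fun k => by simp only [Function.comp_apply]; congr 1; ring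
    have h3 : (0:ℝ) < (3 : ℝ) ^ (-a₀) := Real.rpow_pos_of_pos (by norm_num) _
    obtain ⟨k, hk⟩ := ((ht.eventually (gt_mem_nhds h3)).and (eventually_ge_atTop 1)).exists
    exact absurd (hpow k hk.2).1 (not_le.2 hk.1)

/-! ### The exponent-free conditional milestone -/

/-- **Convergent ray ratios give ray regular variation with one exponent.** If every ray ratio
converges then for some `a` all ratios on all rays tend to `k^{-a}`: cluster points exist
(`uniformRegularity_of_rayRatios`, `exists_seqLimit_of_uniformRegularity`), the limits on each ray
are powers (`exists_rpow_of_rayRatios`), and all exponents equal the axis one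
(`exponent_eq_axis_of_tendsto`). [cite: DuminilCopinICM2022, §8.4] -/
theorem rayRV_of_rayRatios (hR : RayRatios) : ∃ a : ℝ, RayRV[a] := by
  -- a cluster point of the pinned zoom along the meshes `1/(k+1)`
  have hUR := uniformRegularity_of_rayRatios hR
  have hu : Tendsto (fun k : ℕ => (1:ℝ) / ((k:ℝ) + 1)) atTop (𝓝[>] (0:ℝ)) :=
    tendsto_div_succ_nhdsGT one_pos
  obtain ⟨φ, S, hφ, -, hconv, hSpos⟩ := exists_seqLimit_of_uniformRegularity hUR hu
  have huφ : Tendsto ((fun k : ℕ => (1:ℝ) / ((k:ℝ) + 1)) ∘ φ) atTop (𝓝[>] (0:ℝ)) :=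
    hu.comp hφ.tendsto_atTop
  have hconv2 := hconv 2
  -- powers on every ray
  have hpow : ∀ x : Site 3, x ≠ 0 → ∃ a : ℝ, ∀ k : ℕ, 1 ≤ k →
      Tendsto (fun m : ℕ => criticalTwoPoint 3 (fun i => ((k * m : ℕ) : ℤ) * x i) /
        criticalTwoPoint 3 (fun i => ((m : ℕ) : ℤ) * x i)) atTop (𝓝 ((k : ℝ) ^ (-a))) :=
    fun x hx => exists_rpow_of_rayRatios rhoPin_pos huφ hconv2 hSpos hx (hR x hx)
  obtain ⟨a₀, h₀⟩ := hpow (Pi.single 0 1) single_one_ne_zero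
  refine ⟨a₀, fun x hx k hk => ?_⟩
  obtain ⟨a, ha⟩ := hpow x hx
  have hEq : a = a₀ := exponent_eq_axis_of_tendsto h₀ hx ha
  rw [← hEq]
  exact ha k hk

/-- **Exponent-free main theorem of the line.** If for every lattice direction `x ∈ ℤ³ ∖ {0}` and every
`k ≥ 1` the ray ratio `⟨σ₀σ_{kmx}⟩_{β_c} / ⟨σ₀σ_{mx}⟩_{β_c}` of the critical nearest-neighbour Ising
two-point function on `ℤ³` converges as `m → ∞`, then the two-point function is asymptotically
`O(3)`-invariant in the vague sense: `TwoPointAsymptoticIsotropy` (item stmt-CriticalPhenomena-6036).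
[cite: DuminilCopinICM2022, §8.1] -/
theorem twoPointAsymptoticIsotropy_of_rayRatioConvergence
    (h : ∀ x : Site 3, x ≠ 0 → ∀ k : ℕ, 1 ≤ k → ∃ L : ℝ,
      Tendsto (fun m : ℕ => criticalTwoPoint 3 (fun i => ((k * m : ℕ) : ℤ) * x i) /
        criticalTwoPoint 3 (fun i => ((m : ℕ) : ℤ) * x i)) atTop (𝓝 L)) :
    TwoPointAsymptoticIsotropy := by
  obtain ⟨a, hRV⟩ := rayRV_of_rayRatios h
  exact twoPointAsymptoticIsotropy_of_rayRV hRV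

/-- The three forms are equivalent: convergent ray ratios ⟺ ray regular variation with one exponent
⟺ existence of the two-point scaling limit (`rayRV_iff_pairLimit`). [cite: DuminilCopinICM2022, §8.4] -/
theorem rayRatios_iff_rayRV : RayRatios ↔ ∃ a : ℝ, RayRV[a] :=
  ⟨rayRV_of_rayRatios, fun ⟨_, hRV⟩ x hx k hk => ⟨_, hRV x hx k hk⟩⟩

end Summit.CriticalPhenomena.Ising3DConformalLimit.HarmonicMomentsIsotropyTwoPoint.RayRV

end
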